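import Summits.BirchSwinnertonDyer.BirchSwinnertonDyer.Theorems.ThetaPartnerAtTwoSignedKatoUpToAtTwoOffTwoLocalPackageRat
import HarnessLib

/-!
# K3 `SignedKatoDivisibilityUpToAtTwo` (stmt-BirchSwinnertonDyer-20308), line `colemanrat` v3 — WIDTH SEAT 3 (gen 2) SKETCH:
# the SHRUNK PROPOSED TEXT of the ONE `p = 2` research input (the promote-stub decision on (C2)), after the (PT) Selmer
# side has been moved into the kernel (p588330 FineRestriction, p588777 FineSandwich, p589033 OffTwoLocalPackage,
# p589608 FineStrictRat, OffTwoLocalPackageRat), with its kernel certificate «package + Kato 13.4 (2)@2 + GZK ⇒ K3 BY NAME».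

NOT a registered skeleton (the lead owns `Lines/colemanrat.lean`); NOT a tree definition (a `def … : Prop` in a crux workfile for the
planner). Compare `W3_PackageTwoSketch.lean` (w3 g0): the (PT) clause there was `∀ D torsion, ∃ Y j k, (Rec) ∧ (Cover ker k ⊆ range j)`;
HERE `Y`, `k` and the global cover are GONE (kernel theorems), replaced by the LOCAL cover at the unique prime `𝔭 ∣ 2` of `ℚ_∞`,
which is AUTOMATIC for the intended `P := Hom(E⁺(ℚ_{2,∞}) ⊗ ℚ₂/ℤ₂, ℚ₂/ℤ₂)`, `j := ` dual of `Sel⁺ → H¹(ℚ_{∞,𝔭}, E[2^∞])` (divisibility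
of `ℚ/ℤ`): the only GLOBAL content left in (PT) is RECIPROCITY `2^m · j ∘ col = 0` (Poitou–Tate). BSD is not proved by any of this.
-/

set_option autoImplicit false
set_option linter.dupNamespace false

noncomputable section

open scoped Classical MatrixGroups ModularForm NumberField

open CongruenceSubgroup WeierstrassCurve Field IsDedekindDomain NumberField
  Literature.NumberTheory.GaloisRepresentations
  Literature.NumberTheory.EllipticCurves Literature.NumberTheory.EllipticCurves.ModularForms
  Literature.NumberTheory.EllipticCurves.Module Literature.NumberTheory.EllipticCurves.Rank1Residual
  Literature.NumberTheory.EllipticCurves.Kobayashi2003 Literature.NumberTheory.EllipticCurves.Kato2004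
  Literature.NumberTheory.EllipticCurves.Kato2004.EulerSystemValues Literature.NumberTheory.EllipticCurves.GreenbergSelmer
  ZpExtension Summit.BirchSwinnertonDyer.Rank1Residual.Supersingular
  Summit.BirchSwinnertonDyer.BirchSwinnertonDyer.Theorems.SignedKatoOffTwo

namespace Summit.BirchSwinnertonDyer.BirchSwinnertonDyer.Cruxes.SignedKatoDivisibilityUpToAtTwo.ColemanRatW3G2

/-- **PROPOSED ITEM TEXT (conjecture-grade, research at `p = 2`), SHRUNK: the LOCALISED `2`-robust Coleman–zeta package on the
theta habitat, one-place currency.** For every habitat datum and the place `v ∋ 2` of `ℚ`: ∃ pinned `I = 𝐇¹_Γ(T₂E)`, an abstract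
`Λ`-module `P` (the `2`-adic local module `(E⁺(ℚ_{2,∞}) ⊗ ℚ₂/ℤ₂)^∨`), `ι : P → Λ` (Kobayashi's `+`/♭ Coleman map at `2`, kernel killed
by `2^m`), `col : 𝐇¹ → P` (localisation + local Tate pairing), `m`, with
* (Rec+Loc) for every pinned dual datum `D` of `Sel⁺(E/ℚ_∞)` (torsion): some `j : P → X⁺` with `2^m · j ∘ col = 0` (RECIPROCITY — the
  research/global content) and «every `x ∈ X⁺` whose character kills the classes of `Sel⁺_∞` locally trivial at `𝔭` lies in
  `2^m · range j`» (LOCAL COVER — automatic for `j` = dual of `res_𝔭`);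
* (Z) at every height-one `𝔭 ∌ 2`: some `z` in the `Λ`-span of the genuine `2`-adic Euler-system classes with
  `ℓ_𝔭(Λ/(ι col z)) ≤ ℓ_𝔭(Λ/(L♭))`.
[cite: Kobayashi2003, Thm. 6.2–6.3 (p. 11), (7.17)–(7.21), Thm. 7.3 (pp. 12–13)] [cite: Sprung2012, Def. 6.1 (p. 1495), §7 (p. 1499)]
[cite: Kato2004Asterisque, Thm. 12.5–12.6 (p. 222), Conj. 12.10 (p. 224)] [cite: KuriharaOtsuki2006, p. 557] [cite: Otsuki2009, Thm. 3.6 (p. 269), Thm. 4.1 (p. 271, p. 277)] -/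
def LocalRobustZetaSpanPackageTwo (v : HeightOneSpectrum (𝓞 ℚ)) : Prop :=
  ∀ (W : WeierstrassCurve ℚ) [W.IsElliptic] [W.IsGloballyMinimal],
    ¬ W.HasCM → W.analyticRank = 0 → GoodSS W 2 → W.frobeniusTrace 2 = 0 →
    ∀ (κ : ZpExtension ℚ 2) (γ : Field.absoluteGaloisGroup ℚ) (hκ : κ.IsCyclotomic),
      κ.IsTopGenerator γ → IsCyclotomicVariable 2 γ →
      ∀ [NeZero (W.conductorNorm ℤ)] (f : CuspForm (Gamma0 (W.conductorNorm ℤ)) 2),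
        IsNewformOf W f → ∀ (ϖ : ℚ), (ϖ : ℝ) * W.realPeriodRat = plusPeriod f →
      ∀ (Lplus Lminus : IwasawaAlgebra 2), IsPollackPair f 2 Lplus Lminus →
      ∀ [ContinuousSMul ℤ_[2] (W.tateModule 2)] [Module.Free ℤ_[2] (W.tateModule 2)]
        [Module.Finite ℤ_[2] (W.tateModule 2)],
      ∃ (I : Kato2004.IwasawaH1Data W 2 κ γ)
        (P : Type) (_ : AddCommGroup P) (_ : _root_.Module (IwasawaAlgebra 2) P)
        (ι : P →ₗ[IwasawaAlgebra 2] IwasawaAlgebra 2) (col : I.H →ₗ[IwasawaAlgebra 2] P) (m : ℕ),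
        (∀ y, ι y = 0 → (PowerSeries.C (2 : ℤ_[2]) : IwasawaAlgebra 2) ^ m • y = 0) ∧
        (∀ (D : SignedSelmerDualData W κ γ 1), Module.IsTorsion (IwasawaAlgebra 2) D.X →
          ∃ (j : P →ₗ[IwasawaAlgebra 2] D.X),
            (∀ x, (PowerSeries.C (2 : ℤ_[2]) : IwasawaAlgebra 2) ^ m • j (col x) = 0) ∧
            (∀ x : D.X,
              (∀ t : signedSelmerInfty W κ 1,
                resOfLe (W.geomPrimaryTorsion 2) (inf_le_left : κ.kerSubgroup ⊓ decomp v ≤ κ.kerSubgroup)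
                  (t : W.subgroupH1 2 κ.kerSubgroup) = 0 → D.toDual x t = 0) →
              (PowerSeries.C (2 : ℤ_[2]) : IwasawaAlgebra 2) ^ m • x ∈ LinearMap.range j)) ∧
        (∀ 𝔭 : PrimeSpectrum (IwasawaAlgebra 2), 𝔭.asIdeal.height = 1 →
          PowerSeries.C (2 : ℤ_[2]) ∉ 𝔭.asIdeal →
          ∃ z ∈ Submodule.span (IwasawaAlgebra 2) {g : I.H | Kato2004.IsEulerSystemClassTwo W hκ I g},
            lengthAt (IwasawaAlgebra 2) (IwasawaAlgebra 2 ⧸ Ideal.span {ι (col z)}) 𝔭 ≤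
              lengthAt (IwasawaAlgebra 2) (IwasawaAlgebra 2 ⧸ Ideal.span {kobayashiL 1 Lplus Lminus}) 𝔭)

/-- **Kernel certificate: the SHRUNK package at the place above `2` + Kato Thm. 13.4 (2) at `p = 2` (named fact) + Gross–Zagier–Kolyvagin
(named fact) ⇒ K3 BY NAME** (tree theorem `signedKatoDivisibilityUpToAtTwo_of_localRobustZetaSpanPackageTwo_rat_of_pub`).
[cite: Kato2004Asterisque, Thm. 13.4 (2) (p. 226)] [cite: Darmon2004, Thm. 3.22] -/
theorem signedKatoDivisibilityUpToAtTwo_of_localPackage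
    (h134 : Kato2004.thm13_4_two_lengthAt_fineSelmerDual_le_of_isEulerSystemClassTwo)
    (h17 : rank_eq_analyticRank_of_analyticRank_le_one)
    (v : HeightOneSpectrum (𝓞 ℚ)) (hv : ((2 : ℕ) : 𝓞 ℚ) ∈ v.asIdeal) (hPkg : LocalRobustZetaSpanPackageTwo v) :
    Summit.BirchSwinnertonDyer.BirchSwinnertonDyer.Theses.ThetaPartnerAtTwo.SignedKatoDivisibilityUpToAtTwo :=
  signedKatoDivisibilityUpToAtTwo_of_localRobustZetaSpanPackageTwo_rat_of_pub h134 h17 v hv hPkg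

end Summit.BirchSwinnertonDyer.BirchSwinnertonDyer.Cruxes.SignedKatoDivisibilityUpToAtTwo.ColemanRatW3G2

end
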